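import Mathlib.Analysis.InnerProductSpace.Basic
import HarnessLib

/-!
# The discrete Weitzenböck identity for commuting covariant differences: curl² + div² = full gradient²
# (Feynman-gauge quadratic form of lattice gauge theory around a flat / twist-eating background)

Topic `Literature/Analysis/OperatorTheory`.  Theorem-only, Mathlib only, no definitions, no named facts.

SETTING.  An inner product space `E` over `𝕜 = ℝ` or `ℂ` (the space of lattice `su(N)`- or matrix-valued fields
with the Hilbert–Schmidt inner product, one copy per site), a finite index type `ι` (the lattice directions `μ`),
and for each `μ : ι` a map `D μ : E → E` (the forward COVARIANT DIFFERENCE `∇_μ⁺ A(n) = Γ_μ(n) A(n+μ̂) Γ_μ(n)† − A(n)`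
with respect to a background link field) together with a map `Dadj μ : E → E` ADJOINT to it,
`⟪Dadj μ x, y⟫ = ⟪x, D μ y⟫` (minus the backward covariant difference `−∇_μ⁻`), subject to the single algebraic
hypothesis

  `(H)`  `D μ (Dadj ν x) = Dadj ν (D μ x)` for all `μ, ν` —

which holds when `D μ = S μ − 1` for pairwise COMMUTING UNITARY covariant shifts `S μ` (`of_commuting_unitaries`),
i.e. exactly when the background is FLAT IN THE ADJOINT REPRESENTATION: every plaquette holonomy is central —
periodic boxes around `U = 1`, and 't Hooft-twisted boxes around a zero-action (twist-eating) configuration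
(«the simultaneous eigenstates of the `∇_μ⁺` operators (notice that they commute)», García Pérez–González-Arroyo–
Okawa 2017 §2.3).  No linearity of `D μ` is needed for the identity itself.

A lattice 1-form (a fluctuation of the link field) is `a : ι → E`; its linearised field strength («curl») is
`G_{μν} = D μ (a ν) − D ν (a μ)` («`G_{μν}(n) = ∇_μ⁺ A_ν(n) − ∇_ν⁺ A_μ(n) + O(g)`», op. cit. (2.3)); its covariant
divergence is `div a = Σ_μ Dadj μ (a μ)` (the background-field gauge-fixing function «`S_GF = ξ⁻¹ Σ_n Tr(∇_μ⁻ A_μ)²`,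
`∇_μ⁻` minus the adjoint of `∇_μ⁺`», op. cit. §2.5).

RESULTS (namespace `Literature.Analysis.OperatorTheory.DiscreteWeitzenboeck`):

* ★ `half_sum_curl_sq_add_div_sq` — THE IDENTITY
  `½ Σ_μ Σ_ν ‖D μ (a ν) − D ν (a μ)‖² + ‖Σ_μ Dadj μ (a μ)‖² = Σ_μ Σ_ν ‖D μ (a ν)‖²`:
  quadratic Wilson action + Feynman-gauge (`ξ = 1`) fixing term = the componentwise covariant Laplacian form,
  i.e. «in Feynman gauge the propagator of the gauge field reads `P_{μν} = δ_{μν}/q̂²`» (op. cit. §2.5 (Feynman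
  gauge); García Pérez–González-Arroyo–Okawa 2014 §3: `P_{μν} = (δ_{μν} − (1−ξ) p_μp_ν/p²)/p²`);
  `sum_norm_sq_eq_re_inner_laplacian`: `Σ_μ ‖D μ v‖² = re ⟪v, Σ_μ Dadj μ (D μ v)⟫` (the Laplacian `−Δ = Σ ∇_μ⁻∇_μ⁺`);
* ★ `gap_of_div_eq_zero` — COULOMB/LORENZ-GAUGE HESSIAN BOUND: if `div a = 0` and the covariant Laplacian has
  a gap, `m·‖v‖² ≤ Σ_μ ‖D μ v‖²` for all `v`, then `m·Σ_ν ‖a ν‖² ≤ ½ Σ_μ Σ_ν ‖D μ (a ν) − D ν (a μ)‖²` — the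
  tree-level Hessian of the Wilson action at the background, restricted to the gauge slice, inherits the 0-FORM
  gap (for the `ℓ × ℓ` twist-eating `SU(N)` torus that gap is `4 sin²(π/(Nℓ))`,
  `Literature.MathematicalPhysics.QuantumLattice.twistedTorus_poincare_sharp` ∕ `twistedTube_poincare_sharp`:
  momenta «quantized in units of `2π/(N l_μ)` … excluding zero», GPGAO 2014 §3);
  `gap_add_div_sq` (Feynman-gauge form, no gauge condition); ★ `eq_zero_of_curl_eq_zero_of_div_eq_zero` — NO
  HARMONIC 1-FORMS: a positive Laplacian gap leaves no `a ≠ 0` with `curl a = 0` and `div a = 0` (no flat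
  direction transverse to the gauge orbit: «the irreducibility condition eliminates the presence of zero-modes»,
  op. cit. §2.2);
* `curl_of_exact` — gauge modes are curl-free: if the `D μ` commute, `a ν = D ν φ` has `G = 0`;
* `of_commuting_unitaries` — hypothesis `(H)` from commuting unitaries: for additive `S μ` with two-sided inverses
  `Sadj μ` and `S μ ∘ S ν = S ν ∘ S μ`, the differences `S μ − id`, `Sadj μ − id` satisfy `(H)` (and adjointness
  passes from `S` to `S − 1`, `adjoint_sub_id`).

RECIPE for the twisted box (for the line `twisted-slab-continuity`, anchor T1, tree-level step «Hessian ∕ Hodge gap at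
the eater»): `E` = matrix fields on the sites of the `ℓ₀ × ℓ₀ (× L₂ × L₃)` box in axial-free form, `S μ Φ (n) =
Γ_μ(n) Φ(n+μ̂) Γ_μ(n)†` with `Γ` a zero-action configuration of the twisted box (unitary for Hilbert–Schmidt, commuting
because every plaquette of `Γ` is central), `D μ = S μ − 1`; then `gap_of_div_eq_zero` with the 0-form input
`twistedTube_poincare_sharp` gives: Hessian of the Wilson action at the twist eater ≥ `4 sin²(π/(Nℓ₀))·‖a‖²` on
Coulomb-gauge fluctuations, uniformly in `L₂, L₃`.  (The instantiation — building `E` and `S μ` for the Fin box — is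
the consumer's; this file is the operator identity.)

HONEST FRAMING: a finite-dimensional (indeed purely algebraic) identity and its immediate inequalities — TREE LEVEL
only; nothing here controls interacting corrections, `β`-uniformity, vacuum dominance (T1), purity, `IRcof`/`IR`, or
the Yang–Mills mass gap (Clay), which is NOT proved; `R4` closes only `BalabanLadder.UV`.

References: M. García Pérez, A. González-Arroyo, M. Okawa, *Perturbative contributions to Wilson loops in twisted
lattice boxes and reduced models*, JHEP 10 (2017) 150, arXiv:1708.00841, §2.2–§2.5 (corpus `paper:arxiv-1708.00841`
p0006 L19–L35, p0009 L32–L84); M. García Pérez, A. González-Arroyo, M. Okawa, IJMPA 29 (2014) 1445001,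
arXiv:1406.5655, §3 (corpus `paper:arxiv-1406.5655` p0006 L1–L48); G. 't Hooft, Nucl. Phys. B 153 (1979) 141.
-/

namespace Literature.Analysis.OperatorTheory.DiscreteWeitzenboeck

open scoped InnerProductSpace
open RCLike Finset

variable {𝕜 : Type*} [RCLike 𝕜] {E : Type*} [NormedAddCommGroup E] [InnerProductSpace 𝕜 E]
variable {ι : Type*}

/-! ## §1 Adjoint pairs: moving `D` across the inner product -/

section Adjoint

variable {D Dadj : ι → E → E}

/-- The adjoint relation read from the other side: `⟪x, Dadj μ y⟫ = ⟪D μ x, y⟫`. [folklore] -/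
private theorem inner_adj_right (hadj : ∀ μ x y, ⟪Dadj μ x, y⟫_𝕜 = ⟪x, D μ y⟫_𝕜) (μ : ι) (x y : E) :
    ⟪x, Dadj μ y⟫_𝕜 = ⟪D μ x, y⟫_𝕜 := by
  rw [← inner_conj_symm, hadj, inner_conj_symm]

/-- The key cross-term identity: `⟪Dadj μ u, Dadj ν v⟫ = ⟪D ν u, D μ v⟫` under `(H)`. [folklore] -/
private theorem inner_adj_adj (hadj : ∀ μ x y, ⟪Dadj μ x, y⟫_𝕜 = ⟪x, D μ y⟫_𝕜)
    (hcomm : ∀ μ ν x, D μ (Dadj ν x) = Dadj ν (D μ x)) (μ ν : ι) (u v : E) :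
    ⟪Dadj μ u, Dadj ν v⟫_𝕜 = ⟪D ν u, D μ v⟫_𝕜 := by
  rw [hadj, hcomm, inner_adj_right hadj]

variable [Fintype ι]

/-- **The covariant Laplacian form**: `Σ_μ ‖D μ v‖² = re ⟪v, Σ_μ Dadj μ (D μ v)⟫` — the quadratic form of
`−Δ = Σ_μ ∇_μ⁻ ∇_μ⁺` («`∇_μ⁻` is minus the adjoint of `∇_μ⁺`»).
[cite: GarciaperezGonzalezarroyoOkawa2017, §2.5] -/
theorem sum_norm_sq_eq_re_inner_laplacian (hadj : ∀ μ x y, ⟪Dadj μ x, y⟫_𝕜 = ⟪x, D μ y⟫_𝕜) (v : E) :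
    ∑ μ, ‖D μ v‖ ^ 2 = re ⟪v, ∑ μ, Dadj μ (D μ v)⟫_𝕜 := by
  rw [inner_sum, map_sum]
  refine Finset.sum_congr rfl fun μ _ => ?_
  rw [inner_adj_right hadj, inner_self_eq_norm_sq]

end Adjoint

/-! ## §2 The identity `½‖curl a‖² + ‖div a‖² = ‖∇a‖²` -/

section Identity

variable [Fintype ι] {D Dadj : ι → E → E}

/-- Expansion of the gauge-fixing term: `‖Σ_μ Dadj μ (a μ)‖² = Σ_μ Σ_ν re ⟪D ν (a μ), D μ (a ν)⟫`. [folklore] -/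
private theorem norm_div_sq (hadj : ∀ μ x y, ⟪Dadj μ x, y⟫_𝕜 = ⟪x, D μ y⟫_𝕜)
    (hcomm : ∀ μ ν x, D μ (Dadj ν x) = Dadj ν (D μ x)) (a : ι → E) :
    ‖∑ μ, Dadj μ (a μ)‖ ^ 2 = ∑ μ, ∑ ν, re ⟪D ν (a μ), D μ (a ν)⟫_𝕜 := by
  rw [← inner_self_eq_norm_sq (𝕜 := 𝕜), sum_inner, map_sum]
  refine Finset.sum_congr rfl fun μ _ => ?_
  rw [inner_sum, map_sum]
  refine Finset.sum_congr rfl fun ν _ => ?_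
  rw [inner_adj_adj hadj hcomm]

/-- ★ **Discrete Weitzenböck identity** (curl² + div² = gradient²).  For maps `D μ` with adjoints `Dadj μ`
satisfying `D μ ∘ Dadj ν = Dadj ν ∘ D μ` (flat background: commuting unitary covariant shifts) and every lattice
1-form `a`:
`½ Σ_μ Σ_ν ‖D μ (a ν) − D ν (a μ)‖² + ‖Σ_μ Dadj μ (a μ)‖² = Σ_μ Σ_ν ‖D μ (a ν)‖²` — the quadratic Wilson action
around a zero-action configuration plus the `ξ = 1` background-field gauge-fixing term is the componentwise
covariant Laplacian, «in Feynman gauge the propagator of the gauge field reads `δ_{μν}/q̂²`».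
[cite: GarciaperezGonzalezarroyoOkawa2017, §2.5] [cite: GarciaperezGonzalezarroyoOkawa2014, §3] -/
theorem half_sum_curl_sq_add_div_sq (hadj : ∀ μ x y, ⟪Dadj μ x, y⟫_𝕜 = ⟪x, D μ y⟫_𝕜)
    (hcomm : ∀ μ ν x, D μ (Dadj ν x) = Dadj ν (D μ x)) (a : ι → E) :
    (1 / 2 : ℝ) * ∑ μ, ∑ ν, ‖D μ (a ν) - D ν (a μ)‖ ^ 2 + ‖∑ μ, Dadj μ (a μ)‖ ^ 2 =
      ∑ μ, ∑ ν, ‖D μ (a ν)‖ ^ 2 := by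
  rw [norm_div_sq hadj hcomm]
  have hcurl : ∀ μ ν, ‖D μ (a ν) - D ν (a μ)‖ ^ 2 =
      ‖D μ (a ν)‖ ^ 2 + ‖D ν (a μ)‖ ^ 2 - 2 * re ⟪D μ (a ν), D ν (a μ)⟫_𝕜 := by
    intro μ ν
    rw [@norm_sub_sq 𝕜 _ _ _ _ (D μ (a ν)) (D ν (a μ))]
    ring
  simp_rw [hcurl, Finset.sum_sub_distrib, Finset.sum_add_distrib, ← Finset.mul_sum]
  have hP : ∑ μ, ∑ ν, ‖D ν (a μ)‖ ^ 2 = ∑ μ, ∑ ν, ‖D μ (a ν)‖ ^ 2 := Finset.sum_comm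
  have hR : ∑ μ, ∑ ν, re ⟪D ν (a μ), D μ (a ν)⟫_𝕜 = ∑ μ, ∑ ν, re ⟪D μ (a ν), D ν (a μ)⟫_𝕜 := by
    refine Finset.sum_congr rfl fun μ _ => Finset.sum_congr rfl fun ν _ => ?_
    exact inner_re_symm _ _
  rw [hP, hR]
  ring

/-- The same identity with the curl summed over ordered pairs once: for a linear order on the directions,
`Σ_{μ<ν} ‖D μ (a ν) − D ν (a μ)‖² + ‖Σ_μ Dadj μ (a μ)‖² = Σ_μ Σ_ν ‖D μ (a ν)‖²` (the plaquette sum of the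
quadratic Wilson action). [cite: GarciaperezGonzalezarroyoOkawa2017, §2.3] -/
theorem sum_lt_curl_sq_add_div_sq [LinearOrder ι] (hadj : ∀ μ x y, ⟪Dadj μ x, y⟫_𝕜 = ⟪x, D μ y⟫_𝕜)
    (hcomm : ∀ μ ν x, D μ (Dadj ν x) = Dadj ν (D μ x)) (a : ι → E) :
    ∑ μ, ∑ ν ∈ Finset.univ.filter (fun ν => μ < ν), ‖D μ (a ν) - D ν (a μ)‖ ^ 2 + ‖∑ μ, Dadj μ (a μ)‖ ^ 2 =
      ∑ μ, ∑ ν, ‖D μ (a ν)‖ ^ 2 := by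
  rw [← half_sum_curl_sq_add_div_sq hadj hcomm a]
  congr 1
  -- the symmetric double sum is twice the sum over `μ < ν` (the diagonal vanishes)
  have hsym : ∀ μ ν, ‖D μ (a ν) - D ν (a μ)‖ ^ 2 = ‖D ν (a μ) - D μ (a ν)‖ ^ 2 := fun μ ν => by
    rw [← norm_neg, neg_sub]
  have hsplit : ∀ μ, ∑ ν, ‖D μ (a ν) - D ν (a μ)‖ ^ 2 =
      ∑ ν ∈ Finset.univ.filter (fun ν => μ < ν), ‖D μ (a ν) - D ν (a μ)‖ ^ 2 +
        ∑ ν ∈ Finset.univ.filter (fun ν => ν < μ), ‖D μ (a ν) - D ν (a μ)‖ ^ 2 := by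
    intro μ
    rw [← Finset.sum_filter_add_sum_filter_not Finset.univ (fun ν => μ < ν)]
    congr 1
    rw [← Finset.sum_filter_add_sum_filter_not (Finset.univ.filter fun ν => ¬μ < ν) (fun ν => ν < μ)]
    have hdiag : ∑ ν ∈ (Finset.univ.filter fun ν => ¬μ < ν).filter (fun ν => ¬ν < μ),
        ‖D μ (a ν) - D ν (a μ)‖ ^ 2 = 0 := by
      refine Finset.sum_eq_zero fun ν hν => ?_
      simp only [Finset.mem_filter, Finset.mem_univ, true_and, not_lt] at hν
      have : ν = μ := le_antisymm hν.1 hν.2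
      rw [this, sub_self, norm_zero]
      ring
    rw [hdiag, add_zero, Finset.filter_filter]
    refine Finset.sum_congr ?_ fun _ _ => rfl
    ext ν
    simp only [Finset.mem_filter, Finset.mem_univ, true_and, not_lt]
    exact ⟨fun h => h.2, fun h => ⟨h.le, h⟩⟩
  simp_rw [hsplit, Finset.sum_add_distrib]
  have hswap : ∑ μ, ∑ ν ∈ Finset.univ.filter (fun ν => ν < μ), ‖D μ (a ν) - D ν (a μ)‖ ^ 2 =
      ∑ μ, ∑ ν ∈ Finset.univ.filter (fun ν => μ < ν), ‖D μ (a ν) - D ν (a μ)‖ ^ 2 := by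
    rw [Finset.sum_comm' (t' := Finset.univ) (s' := fun ν => Finset.univ.filter fun μ => ν < μ)]
    · refine Finset.sum_congr rfl fun ν _ => Finset.sum_congr rfl fun μ _ => hsym _ _
    · intro μ ν
      simp only [Finset.mem_filter, Finset.mem_univ, true_and, and_true]
  rw [hswap]
  ring

end Identity

/-! ## §3 Consequences: Coulomb-gauge Hessian bound, Feynman-gauge bound, no harmonic 1-forms, exact forms -/

section Consequences

variable [Fintype ι] {D Dadj : ι → E → E}

/-- ★ **Coulomb/Lorenz-gauge Hessian bound.**  If `div a = Σ_μ Dadj μ (a μ) = 0` and the covariant Laplacian has the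
0-form gap `m·‖v‖² ≤ Σ_μ ‖D μ v‖²`, then the linearised Wilson action controls the fluctuation:
`m · Σ_ν ‖a ν‖² ≤ ½ Σ_μ Σ_ν ‖D μ (a ν) − D ν (a μ)‖²` — the tree-level Hessian at a flat (twist-eating) background
has gap `≥ m` on the gauge slice («the irreducibility condition eliminates the presence of zero-modes»; the momenta
are «quantized … excluding zero»). [cite: GarciaperezGonzalezarroyoOkawa2017, §2.2] [cite: GarciaperezGonzalezarroyoOkawa2014, §3] -/
theorem gap_of_div_eq_zero (hadj : ∀ μ x y, ⟪Dadj μ x, y⟫_𝕜 = ⟪x, D μ y⟫_𝕜)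
    (hcomm : ∀ μ ν x, D μ (Dadj ν x) = Dadj ν (D μ x)) {m : ℝ} (hm : ∀ v : E, m * ‖v‖ ^ 2 ≤ ∑ μ, ‖D μ v‖ ^ 2)
    {a : ι → E} (hdiv : ∑ μ, Dadj μ (a μ) = 0) :
    m * ∑ ν, ‖a ν‖ ^ 2 ≤ (1 / 2 : ℝ) * ∑ μ, ∑ ν, ‖D μ (a ν) - D ν (a μ)‖ ^ 2 := by
  have h := half_sum_curl_sq_add_div_sq hadj hcomm a
  rw [hdiv, norm_zero, zero_pow two_ne_zero, add_zero] at h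
  rw [h, Finset.sum_comm, Finset.mul_sum]
  exact Finset.sum_le_sum fun ν _ => hm (a ν)

/-- **Feynman-gauge bound** (no gauge condition): `m · Σ_ν ‖a ν‖² ≤ ½ Σ_μ Σ_ν ‖D μ (a ν) − D ν (a μ)‖² +
‖Σ_μ Dadj μ (a μ)‖²` — the gauge-fixed quadratic action has the gap of the covariant Laplacian.
[cite: GarciaperezGonzalezarroyoOkawa2017, §2.5] -/
theorem gap_add_div_sq (hadj : ∀ μ x y, ⟪Dadj μ x, y⟫_𝕜 = ⟪x, D μ y⟫_𝕜)
    (hcomm : ∀ μ ν x, D μ (Dadj ν x) = Dadj ν (D μ x)) {m : ℝ} (hm : ∀ v : E, m * ‖v‖ ^ 2 ≤ ∑ μ, ‖D μ v‖ ^ 2)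
    (a : ι → E) :
    m * ∑ ν, ‖a ν‖ ^ 2 ≤ (1 / 2 : ℝ) * ∑ μ, ∑ ν, ‖D μ (a ν) - D ν (a μ)‖ ^ 2 + ‖∑ μ, Dadj μ (a μ)‖ ^ 2 := by
  rw [half_sum_curl_sq_add_div_sq hadj hcomm a, Finset.sum_comm, Finset.mul_sum]
  exact Finset.sum_le_sum fun ν _ => hm (a ν)

/-- ★ **No harmonic 1-forms** (no flat direction transverse to the gauge orbit): if the covariant Laplacian has a
POSITIVE gap, a lattice 1-form with vanishing linearised field strength (`D μ (a ν) = D ν (a μ)` for all `μ, ν`)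
and vanishing covariant divergence is zero — the twisted cohomology in degree one vanishes at tree level.
[cite: GarciaperezGonzalezarroyoOkawa2017, §2.2] -/
theorem eq_zero_of_curl_eq_zero_of_div_eq_zero (hadj : ∀ μ x y, ⟪Dadj μ x, y⟫_𝕜 = ⟪x, D μ y⟫_𝕜)
    (hcomm : ∀ μ ν x, D μ (Dadj ν x) = Dadj ν (D μ x)) {m : ℝ} (hm0 : 0 < m)
    (hm : ∀ v : E, m * ‖v‖ ^ 2 ≤ ∑ μ, ‖D μ v‖ ^ 2) {a : ι → E}
    (hcurl : ∀ μ ν, D μ (a ν) = D ν (a μ)) (hdiv : ∑ μ, Dadj μ (a μ) = 0) : a = 0 := by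
  have h := gap_of_div_eq_zero hadj hcomm hm hdiv
  simp_rw [hcurl, sub_self, norm_zero] at h
  rw [zero_pow two_ne_zero] at h
  simp only [Finset.sum_const_zero, mul_zero] at h
  have hsum : ∑ ν, ‖a ν‖ ^ 2 ≤ 0 := by
    by_contra hpos
    push Not at hpos
    have := mul_pos hm0 hpos
    linarith
  have hzero : ∀ ν, ‖a ν‖ ^ 2 = 0 := fun ν =>
    le_antisymm (le_trans (Finset.single_le_sum (fun ν _ => sq_nonneg ‖a ν‖) (Finset.mem_univ ν)) hsum)
      (sq_nonneg _)
  funext ν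
  have := hzero ν
  rw [sq_eq_zero_iff, norm_eq_zero] at this
  exact this

omit [Fintype ι] in
/-- **Gauge modes are curl-free**: if the covariant differences commute (flat background), an exact 1-form
`a ν = D ν φ` has vanishing linearised field strength. [cite: GarciaperezGonzalezarroyoOkawa2017, §2.3] -/
theorem curl_of_exact (hDD : ∀ μ ν x, D μ (D ν x) = D ν (D μ x)) (φ : E) (μ ν : ι) :
    D μ (D ν φ) - D ν (D μ φ) = 0 := by
  rw [hDD, sub_self]

end Consequences

/-! ## §4 The hypotheses from commuting unitary covariant shifts -/

section Unitaries

variable {S Sadj : ι → E →+ E}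

/-- **Adjointness passes to the differences**: if `⟪Sadj μ x, y⟫ = ⟪x, S μ y⟫` then
`⟪(Sadj μ − id) x, y⟫ = ⟪x, (S μ − id) y⟫` («`∇_μ⁻` is now minus the adjoint of `∇_μ⁺`»).
[cite: GarciaperezGonzalezarroyoOkawa2017, §2.5] -/
theorem adjoint_sub_id (hadj : ∀ μ x y, ⟪Sadj μ x, y⟫_𝕜 = ⟪x, S μ y⟫_𝕜) (μ : ι) (x y : E) :
    ⟪Sadj μ x - x, y⟫_𝕜 = ⟪x, S μ y - y⟫_𝕜 := by
  rw [inner_sub_left, inner_sub_right, hadj]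

/-- ★ **Hypothesis `(H)` from commuting unitaries.**  If the covariant shifts `S μ` are additive, pairwise commuting,
and each `Sadj μ` is a two-sided inverse of `S μ` (unitarity: the adjoint is the inverse), then the covariant
differences `D μ = S μ − id`, `Dadj μ = Sadj μ − id` satisfy `D μ ∘ Dadj ν = Dadj ν ∘ D μ` for ALL `μ, ν` — the
background is flat in the adjoint representation («notice that they commute»).
[cite: GarciaperezGonzalezarroyoOkawa2017, §2.3] -/
theorem of_commuting_unitaries (hSS : ∀ μ ν x, S μ (S ν x) = S ν (S μ x))
    (hinv₁ : ∀ μ x, Sadj μ (S μ x) = x) (hinv₂ : ∀ μ x, S μ (Sadj μ x) = x) (μ ν : ι) (x : E) :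
    (S μ (Sadj ν x - x) - (Sadj ν x - x)) = (Sadj ν (S μ x - x) - (S μ x - x)) := by
  -- `S μ` commutes with `Sadj ν = (S ν)⁻¹`
  have hc : S μ (Sadj ν x) = Sadj ν (S μ x) := by
    have h1 : S μ (Sadj ν x) = Sadj ν (S ν (S μ (Sadj ν x))) := (hinv₁ ν _).symm
    rw [h1, ← hSS μ ν, hinv₂]
  rw [map_sub, map_sub, hc]
  abel

/-- The packaged form: with `D μ := S μ − id`, `Dadj μ := Sadj μ − id` built from commuting unitaries as above, both
hypotheses of `half_sum_curl_sq_add_div_sq` hold. [cite: GarciaperezGonzalezarroyoOkawa2017, §2.3] -/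
theorem hypotheses_of_commuting_unitaries (hadj : ∀ μ x y, ⟪Sadj μ x, y⟫_𝕜 = ⟪x, S μ y⟫_𝕜)
    (hSS : ∀ μ ν x, S μ (S ν x) = S ν (S μ x))
    (hinv₁ : ∀ μ x, Sadj μ (S μ x) = x) (hinv₂ : ∀ μ x, S μ (Sadj μ x) = x) :
    (∀ μ x y, ⟪(fun μ x => Sadj μ x - x) μ x, y⟫_𝕜 = ⟪x, (fun μ x => S μ x - x) μ y⟫_𝕜) ∧
    (∀ μ ν x, (fun μ x => S μ x - x) μ ((fun μ x => Sadj μ x - x) ν x) =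
      (fun μ x => Sadj μ x - x) ν ((fun μ x => S μ x - x) μ x)) :=
  ⟨fun μ x y => adjoint_sub_id hadj μ x y, fun μ ν x => of_commuting_unitaries hSS hinv₁ hinv₂ μ ν x⟩

end Unitaries

end Literature.Analysis.OperatorTheory.DiscreteWeitzenboeck
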